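import Summits.AnomalousDissipation.AnomalousDissipation.Theorems.SolenoidalFractalHomogenisationCubatureMoments
import Literature.Analysis.FunctionSpaces.TorusPeriodicLocalization
import HarnessLib

/-!
# K2R `RealisedQuasiStaticCellLaw`, line `floquet-bloch`: the good slot of the cubature word for a sector direction, with the
# sign making the coupling positive (inputs `j`, `θ > 0` of `sectorDecay_ae`; helper towards `stub_lowSectorDecay`;
# `--supports stmt-AnomalousDissipation-20446`)

Summits-side helper file (everything proved; no definitions, no named facts). From F1 (`cubatureWord_exists_goodPhase`): for every
`ℓ ≠ 0` there are a slot `j` of the cubature word and a sign `σ = ±1` such that the coupling of the sector representative `σℓ`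
in slot `j` is positive and bounded below, `∑ᵢ ê_j,i (σℓ)ᵢ ≥ √(7/130)·‖ℓ‖ > 0`, and the slot frequency is transversal enough,
`⟪m_j, ℓ⟫² ≥ (7/130)‖ℓ‖²‖m_j‖²` (`exists_goodSlot_sign`). Since `±ℓ + nℤ³` is symmetric, replacing `ℓ` by `σℓ` does not change the
sector (recipe v2 §(i)); the phases of the stretched words `W'` are those of the cubature word (`LatticeWord_stretch_phase`).
-/

set_option linter.dupNamespace false

noncomputable section

namespace Summit.AnomalousDissipation.AnomalousDissipation.Theorems.SolenoidalFractalHomogenisation.RealisedQuasiStaticCellLaw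

open scoped InnerProductSpace
open Literature.Analysis Literature.Analysis.FunctionSpaces Literature.Analysis.FunctionSpaces.Torus
open Literature.Analysis.FluidPDE Literature.Analysis.FluidPDE.LatticeShear
open Summit.AnomalousDissipation.AnomalousDissipation.Theorems.SolenoidalFractalHomogenisation

/-- The coupling scalar as an inner product: `∑ᵢ eᵢ kᵢ = ⟪e, latticeVec k⟫`. -/
theorem sum_mul_intCast_eq_inner (e : EuclideanSpace ℝ (Fin 3)) (k : Fin 3 → ℤ) :
    ∑ i, e i * (k i : ℝ) = ⟪e, latticeVec k⟫_ℝ := by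
  rw [EuclideanSpace.inner_eq_star_dotProduct, dotProduct]
  refine Finset.sum_congr rfl fun i _ => ?_
  simp [latticeVec_apply, mul_comm]

/-- **Good slot with positive coupling.** For `ℓ ≠ 0` there are a slot `j` of the cubature word and a sign `σ ∈ {1, -1}` with
`√(7/130)·‖ℓ‖ ≤ ∑ᵢ ê_j,i (σℓ)ᵢ` (in particular the coupling is positive) and `(7/130)‖ℓ‖²‖m_j‖² ≤ ⟪m_j, ℓ⟫²`. -/
theorem exists_goodSlot_sign (ℓ : Fin 3 → ℤ) (hℓ : ℓ ≠ 0) :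
    ∃ j : Fin 26, ∃ σ : ℤ, (σ = 1 ∨ σ = -1) ∧
      Real.sqrt (7 / 130) * ‖latticeVec ℓ‖ ≤ ∑ i, (cubatureWord.phase j).e i * (((σ • ℓ) i : ℤ) : ℝ) ∧
      0 < ∑ i, (cubatureWord.phase j).e i * (((σ • ℓ) i : ℤ) : ℝ) ∧
      7 / 130 * (‖latticeVec ℓ‖ ^ 2 * ‖latticeVec (cubatureWord.phase j).m‖ ^ 2) ≤
        ⟪latticeVec (cubatureWord.phase j).m, latticeVec ℓ⟫_ℝ ^ 2 := by
  obtain ⟨j, -, he, hm⟩ := cubatureWord_exists_goodPhase (latticeVec ℓ)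
  set θ₀ : ℝ := ⟪(cubatureWord.phase j).e, latticeVec ℓ⟫_ℝ with hθ₀
  have hq : 1 ≤ ‖latticeVec ℓ‖ := one_le_norm_latticeVec hℓ
  have hc : 0 < Real.sqrt (7 / 130) * ‖latticeVec ℓ‖ := by positivity
  -- `|θ₀| ≥ √(7/130) ‖ℓ‖`
  have habs : Real.sqrt (7 / 130) * ‖latticeVec ℓ‖ ≤ |θ₀| := by
    rw [← Real.sqrt_sq (abs_nonneg θ₀), sq_abs, ← Real.sqrt_sq (norm_nonneg (latticeVec ℓ)), ← Real.sqrt_mul (by norm_num)]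
    exact Real.sqrt_le_sqrt he
  have hsum : ∀ σ : ℤ, ∑ i, (cubatureWord.phase j).e i * (((σ • ℓ) i : ℤ) : ℝ) = (σ : ℝ) * θ₀ := by
    intro σ
    rw [hθ₀, ← sum_mul_intCast_eq_inner, Finset.mul_sum]
    refine Finset.sum_congr rfl fun i _ => ?_
    simp; ring
  by_cases hsign : 0 ≤ θ₀
  · refine ⟨j, 1, Or.inl rfl, ?_, ?_, hm⟩
    · rw [hsum]; push_cast; rw [one_mul]; rwa [abs_of_nonneg hsign] at habs
    · rw [hsum]; push_cast; rw [one_mul]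
      rw [abs_of_nonneg hsign] at habs; linarith
  · push Not at hsign
    refine ⟨j, -1, Or.inr rfl, ?_, ?_, hm⟩
    · rw [hsum]; push_cast; rw [abs_of_neg hsign] at habs; linarith
    · rw [hsum]; push_cast; rw [abs_of_neg hsign] at habs; linarith

end Summit.AnomalousDissipation.AnomalousDissipation.Theorems.SolenoidalFractalHomogenisation.RealisedQuasiStaticCellLaw

end
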